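import Summits.AtomisticToContinuum.Crystallization.Theorems.OverbindingBudgetHullEngine
import Summits.AtomisticToContinuum.Crystallization.Theorems.OverbindingBudgetPatchContinuityTwo
import Summits.AtomisticToContinuum.Crystallization.Theorems.OverbindingBudgetRecurrentSealClosure

/-!
# OverbindingBudget — law 4 (`SealedChargeLaw`) REDUCED TO ITS EXTREMAL CLASS: rooted, uniformly recurrent, robustly sealed textures
(helper, `--supports stmt-AtomisticToContinuum-31280`; decomp-a2c lens 4 «minimal counterexample / extremal reduction», generation 21)

Route `OverbindingBudget` (Crystallization), crux `RobustDefectLimitWindows` (stmt-AtomisticToContinuum-31280), registered line v7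
«HostedDustCut» (sha 624a0fa0…).  Its stub 4, `stub_sealedChargeLaw` = `SealedChargeLaw 24 48 10` (…WallTensionLever, pin
`sealedChargeLaw_numerals_iff`), is one of the four LOAD-BEARING stubs of the line (…MinimalCone, generation 20) and the one the cell critic
judged nearest to proof-readiness (CRITIC-LEDGER row 258).  Nothing is registered, re-cut or re-typed here (waivers (w2)/(w3)): this file
proves, complete and over landed Theorems files only, a NORMAL-FORM THEOREM about the registered text —

**`sealedChargeLaw_of_recurrentSealedChargeLaw : RecurrentSealedChargeLaw W₀ P₀ → SealedChargeLaw W₀ P₀ r₀`** (every `W₀ P₀ r₀`; at the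
registered numerals `sealedChargeLaw_numerals_of_recurrent : RecurrentSealedChargeLaw 24 48 → SealedChargeLaw 24 48 10`).

Here `RecurrentSealedChargeLaw W₀ P₀` (§F) is law 4 restricted to its EXTREMAL CLASS and at the same time relieved of three hypotheses:
the texture `Y` may be assumed ROOTED (`0 ∈ Y`) and UNIFORMLY RECURRENT (`UniformlyRecurrent`: every `R`-patch recurs with bounded gaps up
to `ε`, in the two-way local matching sense `Match` of `MuGSC`), the Barlow-matrix hypothesis `MAT a Y` and the thin-core hypothesis
`ThinCores a r₀ Y` are DROPPED (the conclusion never needed them once recurrence is available — they are not limit-closed and the reduction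
cannot carry them, so the normal form is honestly STRONGER-in-kind on that axis), the covering radius is the closed `≤ 9/10`, and the sealed
pairs are ROBUSTLY sealed (`RobustlySealedDense`: non-linkage only by contact paths of ROBUSTLY clean sites at every positive margin, instead of
`SealedDense`'s non-linkage by `t`-LOOSENED clean paths — a weaker sealing hypothesis, i.e. more textures to charge; forced, because loosened
cleanness is not limit-closed at the fixed shell radius `1.02 a` of `CleanT`).

PROOF (the lens, applied to law 4's would-be counterexamples).  Suppose a texture `Y` satisfies the hypotheses of law 4 but is FLAT: for every
`η > 0` all cubes of side `≥ m η` carry site charge `∑ (φ_Y − 2e) ≤ η ℓ³` (§F `FlatMod`, the negation of the conclusion with its threshold made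
a modulus).  Consider the HULL FAMILY (§F `Hull`) of rooted, `δ`-separated, `9/10`-covering textures that are hull-stably sealed (§F `WSeal`:
`L`-dense pairs clean at every margin `s < t`, width `≤ W₀+1`, not linked at any margin `s > 0`) and flat with the same modulus.  It contains
`Y − y₀` (§G, translation covariance), is closed under re-rooting (§G) and under local limits (§I: `solid_of_limit`; `wSeal_of_limit` — robust
cleanness is transported ALONG a fine matching by the two-set patch transport `cleanT_transport₂` of §D with margin loss `3ε`, absorbed by the
open margin range, a robust contact path in the limit transports BACK to the approximants at margin `s − 3ε > 0`, and the finitely many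
candidate partner pairs near `p` are pigeonholed along `ε → 0⁺`; `flatMod_of_limit` — shift the cube down by `τ/2` so that no limit site near a
face moves, match its sites bijectively with an approximant's sites in the shifted cube, and compare fields by the two-set patch continuity
`field_continuity₂` of §E, error `θ·#F < θ'`).  By the HULL ENGINE `minimalRecurrent` (§C; Zorn on closed shift-invariant subfamilies in
the compact metrisable local-matching topology + almost periodicity of minimal points, Birkhoff) the family contains a UNIFORMLY RECURRENT
member `Z`; `Z` is rooted, uniformly discrete, `9/10`-covering and robustly sealed-dense at margin `t/2`, so `RecurrentSealedChargeLaw` charges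
it — contradicting its flatness (§J).

WHY THIS IS THE LENS-4 MOVE ON LAW 4 (and what it buys).  A minimal (= recurrent) flat sealed texture is the extremal counterexample: every
finite configuration it shows — in particular every sealed pair together with its blocking walls — REAPPEARS SYNDETICALLY, with density
bounded below by `1/G(R,ε)³`.  The intended proof of law 4 («incoherent interfaces carry positive tension, no far field», critic rows 96/258)
needs exactly a DENSITY of priced defects per unit volume; on the recurrent class that density is given for free by recurrence and the proof
reduces to pricing ONE recurring sealed patch (a local, instrumentable statement: I-RSE below), while uniform discreteness + recurrence also
kills the «sparse defects along a sequence of cubes» escape that makes the general law need `MAT`/`ThinCores` bookkeeping.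

PORT NOTE (§A–§C).  The hull engine is the tree's `CleanHull.stub_minimalRecurrent` (…GappedShellCensusCleanLimitsHaveWindowsMinimalRecurrent)
with the sequential compactness of Literature `LocalMatchingCompactness`; both live over `MuGroundStateConfiguration.lean`, whose declaration
`Literature.MathematicalPhysics.StatisticalMechanics.UniformlyDiscrete` CLASHES with the one of `MuGSC.lean` imported by every OverbindingBudget
file (checked: `import` of both fails with «environment already contains …UniformlyDiscrete»).  §A–§C are therefore a VERBATIM PORT of those two
kernels to the `MuGSC` world (`BallMatch ε R A B` ↦ `Match ε R 0 A B`, same proofs), kept `private` except for the two entry points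
`exists_subseq_forall_eventually_match` and `minimalRecurrent`.  The port is ALSO the missing last step of the open item
stmt-AtomisticToContinuum-26048 (`RecurrentMuStableLimit`, MuGSC world), which lacked exactly a Birkhoff kernel over `Match`.

PIECES / TAGS (decomp-a2c bookkeeping).  Target ⟸ [T] ∧ [RSE]:  [T] = this file's theorem, PROVED (0 sorry);  [RSE] = `RecurrentSealedChargeLaw
24 48`: XL · IDEA-NEEDED (positivity of the tension of a recurring incoherent sealed patch) · INSTRUMENTABLE (I-RSE: the cheapest PERIODIC
textures of covering radius ≤ 9/10 containing a robustly sealed clean pair of width ≤ 25 per period — a finite-dimensional variational problem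
per period box; flat periodic sealed textures would refute [RSE] and law 4 alike) · STRONGER-in-kind than the registered stub on the
`MAT`/`ThinCores`/`<9/10`/robust-sealing axes (above), WEAKER on the rooted/recurrent axis.  No piece is COSTUME: [RSE] does not mention
`SealedChargeLaw`'s general textures and the probes `[RSE] → Crystallization`, `SealedChargeLaw 24 48 10 → [RSE]` fail (bc/probes21.lean).

FILES OF THE NODE (seven, by the 400-line rule; all `--supports stmt-AtomisticToContinuum-31280`).  §A `…OverbindingBudgetMatchCompactness`
(local-matching compactness over `Match`, port);  §B–§C `…OverbindingBudgetHullEngine` (`minimalRecurrent`, port);  §D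
`…OverbindingBudgetPatchTransportTwo` (`cleanT_transport₂`);  §E `…OverbindingBudgetPatchContinuityTwo` (`field_continuity₂`);  §F–§G
`…OverbindingBudgetRecurrentSealStatements` (the statements `UniformlyRecurrent`, `RobustlySealedDense`, `RecurrentSealedChargeLaw`, `FlatMod`,
`WSeal`, `Hull`; margins, coordinates, translation covariance);  §H–§I `…OverbindingBudgetRecurrentSealClosure` (`cleanT_of_match`,
`solid_of_limit`, `wSeal_of_limit`);  THIS FILE: §I (ii) `flatMod_of_limit`, §J the reduction and the pins to the registered numerals.
-/

noncomputable section

namespace Summit.AtomisticToContinuum.Crystallization.Theorems.OverbindingBudgetRecurrentSeal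

open Filter Metric Set Topology
open Literature.MathematicalPhysics.StatisticalMechanics
open Literature.Geometry.DiscreteGeometry (ShellCloseTo fccKissingPattern hcpKissingPattern EtaMatched
  card_eq_twelve_of_shellCloseTo)
open Summit.AtomisticToContinuum.Crystallization.Theorems.OverbindingBudgetWallTensionLever (CleanT TouchT Linked
  SealedDense MAT ThinCores BarlowClose SealedChargeLaw WallTension sealedChargeLaw_numerals_iff cube_subset_closedBall)
open Summit.AtomisticToContinuum.Crystallization.Theorems.OverbindingBudgetGradedBareness (cleanT_anti)
open Summit.AtomisticToContinuum.Crystallization.Theorems.OverbindingBudgetCleanlessCut (margin_le_of_cleanT)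
open Summit.AtomisticToContinuum.Crystallization.Theorems.OverbindingBudgetExcessInstability (finite_inter_cube)
open Summit.AtomisticToContinuum.Crystallization.Theorems.OverbindingBudgetMatchCompactness
open Summit.AtomisticToContinuum.Crystallization.Theorems.OverbindingBudgetHullEngine (minimalRecurrent)
open Summit.AtomisticToContinuum.Crystallization.Theorems.OverbindingBudgetPatchContinuityTwo (field_continuity₂)
open Summit.AtomisticToContinuum.Crystallization.Theorems.OverbindingBudgetRecurrentSealStatements
open Summit.AtomisticToContinuum.Crystallization.Theorems.OverbindingBudgetRecurrentSealClosure

/-! ## §I (ii)  Limit closure of flatness -/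

/-- Flatness with a modulus passes to local limits: shift the cube down by a small `τ/2` (no site of the limit
near a face moves in or out), match its sites bijectively with the sites of an approximant in the shifted cube,
and compare the fields by two-set patch continuity. [folklore] -/
theorem flatMod_of_limit {δ e : ℝ} {m : ℝ → ℝ} (hδ : 0 < δ) {Zs : ℕ → Set (EuclideanSpace ℝ (Fin 3))} {Z : Set (EuclideanSpace ℝ (Fin 3))}
    (hsepk : ∀ k, ∀ p ∈ Zs k, ∀ q ∈ Zs k, p ≠ q → δ ≤ dist p q)
    (hsep : ∀ p ∈ Z, ∀ q ∈ Z, p ≠ q → δ ≤ dist p q)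
    (hconv : ∀ R ε : ℝ, 0 < ε → ∀ᶠ k in atTop, Match ε R 0 (Zs k) Z) (hF : ∀ k, FlatMod e m (Zs k)) :
    FlatMod e m Z := by
  classical
  intro η hη ℓ c F hℓ hFZ
  rcases lt_or_ge ℓ 0 with hℓ0 | hℓ0
  · -- negative side: the cube is empty, and so is the approximants' — whose flatness is then absurd too
    have hempty : ∀ X : Set (EuclideanSpace ℝ (Fin 3)), X ∩ {z : (EuclideanSpace ℝ (Fin 3)) | ∀ i : Fin 3, c i ≤ z i ∧ z i < c i + ℓ} = ∅ := by
      intro X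
      ext z
      simp only [Set.mem_inter_iff, Set.mem_setOf_eq, Set.mem_empty_iff_false, iff_false, not_and]
      intro _ h
      have := h 0
      linarith [this.1, this.2]
    have h0 := hF 0 η hη ℓ c ∅ hℓ (by rw [Finset.coe_empty, hempty])
    have hF0 : F = ∅ := by rw [← Finset.coe_eq_empty, hFZ, hempty]
    rw [hF0]
    rw [Finset.sum_empty] at h0 ⊢
    exact h0
  refine le_of_forall_pos_lt_add fun θ' hθ' => ?_
  set θ : ℝ := θ' / ((F.card : ℝ) + 1) with hθ
  have hθ0 : 0 < θ := by positivity
  obtain ⟨Rθ, εθ, hεθ, hcont⟩ := field_continuity₂ hδ hθ0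
  -- shift room `τ`
  set one : (EuclideanSpace ℝ (Fin 3)) := WithLp.toLp 2 (fun _ : Fin 3 => (1 : ℝ)) with hone
  have hone_i : ∀ i : Fin 3, (c - one) i = c i - 1 := fun i => by simp [hone]
  have hUDZ : UniformlyDiscrete Z := ⟨δ, hδ, hsep⟩
  set S₀ : Set (EuclideanSpace ℝ (Fin 3)) := Z ∩ {z : (EuclideanSpace ℝ (Fin 3)) | ∀ i : Fin 3, (c - one) i ≤ z i ∧ z i < (c - one) i + (ℓ + 2)} with hS₀
  have hS₀fin : S₀.Finite := finite_inter_cube hUDZ (c - one) (by linarith)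
  have h1 : ∀ᶠ τ in 𝓝[>] (0 : ℝ), ∀ w ∈ S₀, ∀ i : Fin 3,
      (w i < c i → τ < c i - w i) ∧ (w i < c i + ℓ → τ < c i + ℓ - w i) := by
    refine hS₀fin.eventually_all.2 fun w _ => eventually_all.2 fun i => Filter.Eventually.and ?_ ?_
    · by_cases hw : w i < c i
      · exact ((eventually_lt_nhds (by linarith : (0 : ℝ) < c i - w i)).filter_mono nhdsWithin_le_nhds).mono
          fun τ h _ => h
      · exact Eventually.of_forall fun τ h => absurd h hw
    · by_cases hw : w i < c i + ℓ
      · exact ((eventually_lt_nhds (by linarith : (0 : ℝ) < c i + ℓ - w i)).filter_mono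
          nhdsWithin_le_nhds).mono fun τ h _ => h
      · exact Eventually.of_forall fun τ h => absurd h hw
  have h2 : ∀ᶠ τ in 𝓝[>] (0 : ℝ), τ < 1 := (eventually_lt_nhds one_pos).filter_mono nhdsWithin_le_nhds
  have h3 : ∀ᶠ τ in 𝓝[>] (0 : ℝ), 0 < τ := eventually_mem_nhdsWithin
  obtain ⟨τ, hτ1, hτ2, hτ3⟩ := (h1.and (h2.and h3)).exists
  -- one approximant, matched finely on a large ball
  set R : ℝ := ‖c‖ + 3 * (ℓ + 2) + |Rθ| + 10 with hR
  set ε : ℝ := min (τ / 4) (min (δ / 4) (εθ / 2)) with hε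
  have hε0 : 0 < ε := by positivity
  have hετ : ε ≤ τ / 4 := min_le_left _ _
  have hεδ : ε ≤ δ / 4 := (min_le_right _ _).trans (min_le_left _ _)
  have hεθ' : ε ≤ εθ / 2 := (min_le_right _ _).trans (min_le_right _ _)
  obtain ⟨k, hk⟩ := (hconv R ε hε0).exists
  -- the sites of the cube
  have hFmem : ∀ y, y ∈ F ↔ y ∈ Z ∧ ∀ i : Fin 3, c i ≤ y i ∧ y i < c i + ℓ := fun y => by
    rw [← Finset.mem_coe, hFZ]; rfl
  have hFS₀ : ∀ y ∈ F, y ∈ S₀ := fun y hy => by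
    obtain ⟨hyZ, hyc⟩ := (hFmem y).1 hy
    exact ⟨hyZ, fun j => by have := hyc j; rw [hone_i]; constructor <;> linarith [this.1, this.2]⟩
  have hFtop : ∀ y ∈ F, ∀ i : Fin 3, y i < c i + ℓ - τ := by
    intro y hy i
    have := (hτ1 y (hFS₀ y hy) i).2 (((hFmem y).1 hy).2 i).2
    linarith
  have hnormS₀ : ∀ w ∈ S₀, ‖w‖ ≤ ‖c‖ + 3 * (ℓ + 2) := by
    intro w hw
    have hd : dist w c ≤ 3 * (ℓ + 2) :=
      dist_le_three_mul (by linarith) fun i => by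
        have := hw.2 i; rw [hone_i] at this; rw [abs_le]; constructor <;> linarith [this.1, this.2]
    have := norm_le_insert' w c
    rw [← dist_eq_norm] at this
    linarith
  -- partner map on `F`
  have hpart : ∀ y, ∃ w : (EuclideanSpace ℝ (Fin 3)), y ∈ F → w ∈ Zs k ∧ dist w y ≤ ε := by
    intro y
    by_cases hy : y ∈ F
    · have hy0 : dist y 0 ≤ R := by
        rw [dist_zero_right]; linarith [hnormS₀ y (hFS₀ y hy), abs_nonneg Rθ]
      obtain ⟨w, hw, hwd⟩ := hk.1 y ((hFmem y).1 hy).1 hy0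
      exact ⟨w, fun _ => ⟨hw, hwd⟩⟩
    · exact ⟨0, fun h => absurd h hy⟩
  choose mp hmp using hpart
  have hminj : Set.InjOn mp ↑F := by
    intro y₁ hy₁ y₂ hy₂ heq
    have hy₁' := Finset.mem_coe.1 hy₁
    have hy₂' := Finset.mem_coe.1 hy₂
    by_contra hne
    have hδle := hsep y₁ ((hFmem y₁).1 hy₁').1 y₂ ((hFmem y₂).1 hy₂').1 hne
    have h1 := (hmp y₁ hy₁').2
    have h2 := (hmp y₂ hy₂').2
    rw [heq] at h1
    have : dist y₁ y₂ ≤ ε + ε :=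
      (dist_triangle y₁ (mp y₂) y₂).trans (add_le_add (by rw [dist_comm]; exact h1) h2)
    linarith
  -- the shifted cube and its sites in the approximant
  set c' : (EuclideanSpace ℝ (Fin 3)) := c - WithLp.toLp 2 (fun _ : Fin 3 => τ / 2) with hc'
  have hc'i : ∀ i : Fin 3, c' i = c i - τ / 2 := fun i => by simp [hc']
  have hF'coe : (↑(F.image mp) : Set (EuclideanSpace ℝ (Fin 3))) = Zs k ∩ {z : (EuclideanSpace ℝ (Fin 3)) | ∀ i : Fin 3, c' i ≤ z i ∧ z i < c' i + ℓ} := by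
    apply Set.Subset.antisymm
    · intro w hw
      rw [Finset.coe_image] at hw
      obtain ⟨y, hy, rfl⟩ := hw
      have hy' := Finset.mem_coe.1 hy
      obtain ⟨hmem, hd⟩ := hmp y hy'
      refine ⟨hmem, fun i => ?_⟩
      have hci := ((hFmem y).1 hy').2 i
      have htop := hFtop y hy' i
      have hco := abs_le.1 (abs_coord_sub_le hd i)
      rw [hc'i]
      constructor <;> linarith [hco.1, hco.2]
    · rintro w ⟨hwk, hwc⟩
      have hwS : ∀ i : Fin 3, |w i - c i| ≤ ℓ + 2 := fun i => by
        have := hwc i; rw [hc'i] at this; rw [abs_le]; constructor <;> linarith [this.1, this.2]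
      have hw0 : dist w 0 ≤ R := by
        rw [dist_zero_right]
        have hd : dist w c ≤ 3 * (ℓ + 2) := dist_le_three_mul (by linarith) hwS
        have := norm_le_insert' w c
        rw [← dist_eq_norm] at this
        linarith [abs_nonneg Rθ]
      obtain ⟨x, hx, hxd⟩ := hk.2 w hwk hw0
      have hxco : ∀ i, |w i - x i| ≤ ε := fun i => abs_coord_sub_le hxd i
      have hxS : x ∈ S₀ := ⟨hx, fun i => by
        have hw1 := hwc i; have hx1 := abs_le.1 (hxco i); rw [hc'i] at hw1; rw [hone_i]
        constructor <;> linarith [hw1.1, hw1.2, hx1.1, hx1.2]⟩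
      have hxc : ∀ i : Fin 3, c i ≤ x i ∧ x i < c i + ℓ := by
        intro i
        have hw1 := hwc i; have hx1 := abs_le.1 (hxco i); rw [hc'i] at hw1
        obtain ⟨hlow, -⟩ := hτ1 x hxS i
        constructor
        · by_contra hlt
          push Not at hlt
          have := hlow hlt
          linarith [hw1.1, hx1.1, hx1.2]
        · linarith [hw1.2, hx1.1, hx1.2]
      have hxF : x ∈ F := (hFmem x).2 ⟨hx, hxc⟩
      have hmx : mp x = w := by
        by_contra hne
        obtain ⟨hm1, hm2⟩ := hmp x hxF
        have hδle := hsepk k (mp x) hm1 w hwk hne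
        have : dist (mp x) w ≤ ε + ε := (dist_triangle (mp x) x w).trans (add_le_add hm2 (by rw [dist_comm]; exact hxd))
        linarith
      rw [Finset.coe_image]
      exact ⟨x, Finset.mem_coe.2 hxF, hmx⟩
  -- flatness of the approximant on the shifted cube, pulled back to `F`
  have hflatk := hF k η hη ℓ c' (F.image mp) hℓ hF'coe
  rw [Finset.sum_image hminj] at hflatk
  -- fields compared site by site
  have hfield : ∀ y ∈ F, (∑' w : ↥Z, lennardJones (dist y (w : (EuclideanSpace ℝ (Fin 3))))) ≤
      (∑' w : ↥(Zs k), lennardJones (dist (mp y) (w : (EuclideanSpace ℝ (Fin 3))))) + θ := by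
    intro y hy
    obtain ⟨hm1, hm2⟩ := hmp y hy
    have hyZ := ((hFmem y).1 hy).1
    have hny := hnormS₀ y (hFS₀ y hy)
    have h := hcont Z (Zs k) hsep (hsepk k) y hyZ (mp y) hm1 ?_ ?_
    · linarith [(abs_le.1 h).1]
    · intro w hw hwd
      have hw0 : dist w 0 ≤ R := by
        rw [dist_zero_right]
        have := norm_le_insert' w y
        rw [← dist_eq_norm] at this
        linarith [le_abs_self Rθ]
      obtain ⟨w', hw', hw'd⟩ := hk.1 w hw hw0
      refine ⟨w', hw', ?_⟩
      calc dist (w' - mp y) (w - y) ≤ dist w' w + dist (mp y) y := dist_sub_sub_le _ _ _ _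
        _ ≤ ε + ε := add_le_add hw'd hm2
        _ ≤ εθ := by linarith
    · intro w' hw' hw'd
      have hw'0 : dist w' 0 ≤ R := by
        rw [dist_zero_right]
        have h1 := norm_le_insert' w' (mp y)
        have h2 := norm_le_insert' (mp y) y
        rw [← dist_eq_norm] at h1 h2
        linarith [le_abs_self Rθ]
      obtain ⟨w, hw, hwd⟩ := hk.2 w' hw' hw'0
      refine ⟨w, hw, ?_⟩
      calc dist (w' - mp y) (w - y) ≤ dist w' w + dist (mp y) y := dist_sub_sub_le _ _ _ _
        _ ≤ ε + ε := add_le_add hwd hm2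
        _ ≤ εθ := by linarith
  have hsum : ∑ y ∈ F, ((∑' w : ↥Z, lennardJones (dist y (w : (EuclideanSpace ℝ (Fin 3))))) - 2 * e) ≤
      ∑ y ∈ F, ((∑' w : ↥(Zs k), lennardJones (dist (mp y) (w : (EuclideanSpace ℝ (Fin 3))))) - 2 * e) + θ * F.card := by
    have h := Finset.sum_le_sum fun y (hy : y ∈ F) =>
      (show (∑' w : ↥Z, lennardJones (dist y (w : (EuclideanSpace ℝ (Fin 3))))) - 2 * e ≤
          ((∑' w : ↥(Zs k), lennardJones (dist (mp y) (w : (EuclideanSpace ℝ (Fin 3))))) - 2 * e) + θ by linarith [hfield y hy])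
    rw [Finset.sum_add_distrib, Finset.sum_const, nsmul_eq_mul] at h
    linarith
  have hθF : θ * F.card < θ' := by
    rw [hθ, div_mul_eq_mul_div, div_lt_iff₀ (by positivity)]
    nlinarith
  linarith [hflatk]

/-! ## §J  The reduction -/

/-- **Law 4 reduces to its recurrent class.**  `RecurrentSealedChargeLaw W₀ P₀ → SealedChargeLaw W₀ P₀ r₀`
for every `r₀`: the Barlow-matrix and thin-core hypotheses of law 4 are not needed, the sealed pairs may be
replaced by ROBUSTLY sealed ones, and the texture may be assumed rooted and UNIFORMLY RECURRENT.  Proof: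
were a sealed texture `Y` flat (site charge `≤ η ℓ³` on all large cubes, every `η > 0`), the family of rooted,
separated, covering, hull-stably sealed, equally flat textures is non-empty (`Y - y₀`), re-rooting closed
(translation covariance) and closed under local limits (`solid_of_limit`, `wSeal_of_limit`,
`flatMod_of_limit`), so by the hull engine `minimalRecurrent` it contains a uniformly recurrent texture, which
the recurrent law charges — contradicting its flatness. -/
theorem sealedChargeLaw_of_recurrentSealedChargeLaw (W₀ : ℝ) (P₀ : ℕ) (r₀ : ℝ)
    (h : RecurrentSealedChargeLaw W₀ P₀) : SealedChargeLaw W₀ P₀ r₀ := by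
  classical
  intro e hT hLB Y hUD hcov a ha ha1 t ht _hMAT _hThin hSD
  by_contra hnot
  -- flatness modulus of `Y`
  have hflat : ∀ η : ℝ, ∃ ℓ₀ : ℝ, 0 < η → ∀ ℓ : ℝ, ∀ c : (EuclideanSpace ℝ (Fin 3)), ∀ F : Finset (EuclideanSpace ℝ (Fin 3)), ℓ₀ ≤ ℓ →
      (↑F : Set (EuclideanSpace ℝ (Fin 3))) = Y ∩ {z | ∀ i : Fin 3, c i ≤ z i ∧ z i < c i + ℓ} →
      ∑ y ∈ F, ((∑' w : ↥Y, lennardJones (dist y (w : (EuclideanSpace ℝ (Fin 3))))) - 2 * e) ≤ η * ℓ ^ 3 := by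
    intro η
    by_cases hη : 0 < η
    · by_contra hcon
      push Not at hcon
      exact hnot ⟨η, hη, fun ℓ₀ => (hcon ℓ₀).2⟩
    · exact ⟨0, fun h' => absurd h' hη⟩
  choose m hm using hflat
  have hFlatY : FlatMod e m Y := fun η hη ℓ c F hℓ hF => hm η hη ℓ c F hℓ hF
  obtain ⟨δ, hδ, hsepY⟩ := hUD
  obtain ⟨L, hL⟩ := hSD
  have ha0 : 0 < a := by linarith
  have hWY : WSeal a t (W₀ + 1) P₀ L Y := by
    intro p hp
    obtain ⟨y, hy, y', hy', hd, hc, hc', hW, hnl⟩ := hL p hp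
    have hta : t ≤ a / 50 := margin_le_of_cleanT hc
    exact ⟨y, hy, y', hy', hd, fun s hs hst => ⟨cleanT_anti ha0 (by linarith) hst.le hc,
      cleanT_anti ha0 (by linarith) hst.le hc'⟩, hW,
      fun s hs hlk => hnl (linked_anti ha0 (by linarith) (by linarith) hlk)⟩
  have hSolidY : ∀ z : (EuclideanSpace ℝ (Fin 3)), ∃ w ∈ Y, dist z w ≤ 9 / 10 := fun z =>
    let ⟨w, hw, hd⟩ := hcov z
    ⟨w, hw, hd.le⟩
  -- the hull family
  obtain ⟨y₀, hy₀, -⟩ := hcov 0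
  have hne : (Hull δ a t (W₀ + 1) P₀ L e m).Nonempty :=
    ⟨(fun p => p - y₀) '' Y, mem_hull.2 ⟨⟨y₀, hy₀, sub_self y₀⟩, sep_translate y₀ hsepY,
      solid_translate y₀ hSolidY, wSeal_translate y₀ hWY, flatMod_translate y₀ hFlatY⟩⟩
  have hsepC : ∀ Z ∈ Hull δ a t (W₀ + 1) P₀ L e m, ∀ p ∈ Z, ∀ q ∈ Z, p ≠ q → δ ≤ dist p q :=
    fun Z hZ => (mem_hull.1 hZ).2.1
  have h0C : ∀ Z ∈ Hull δ a t (W₀ + 1) P₀ L e m, (0 : (EuclideanSpace ℝ (Fin 3))) ∈ Z := fun Z hZ => (mem_hull.1 hZ).1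
  have hrootC : ∀ Z ∈ Hull δ a t (W₀ + 1) P₀ L e m, ∀ z ∈ Z, (fun p => p - z) '' Z ∈ Hull δ a t (W₀ + 1) P₀ L e m := by
    intro Z hZ z hz
    obtain ⟨-, h2, h3, h4, h5⟩ := mem_hull.1 hZ
    exact mem_hull.2 ⟨⟨z, hz, sub_self z⟩, sep_translate z h2, solid_translate z h3, wSeal_translate z h4,
      flatMod_translate z h5⟩
  have hclosedC : ∀ Zs : ℕ → Set (EuclideanSpace ℝ (Fin 3)), (∀ k, Zs k ∈ Hull δ a t (W₀ + 1) P₀ L e m) → ∀ Z : Set (EuclideanSpace ℝ (Fin 3)),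
      (0 : (EuclideanSpace ℝ (Fin 3))) ∈ Z → (∀ p ∈ Z, ∀ q ∈ Z, p ≠ q → δ ≤ dist p q) →
      (∀ R ε : ℝ, 0 < ε → ∀ᶠ k in atTop, Match ε R 0 (Zs k) Z) → Z ∈ Hull δ a t (W₀ + 1) P₀ L e m := by
    intro Zs hZs Z hZ0 hZsep hconv
    have hk := fun k => mem_hull.1 (hZs k)
    exact mem_hull.2 ⟨hZ0, hZsep, solid_of_limit hδ hZsep hconv fun k => (hk k).2.2.1,
      wSeal_of_limit hδ ha ha1 (fun k => (hk k).2.1) hZsep hconv fun k => (hk k).2.2.2.1,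
      flatMod_of_limit hδ (fun k => (hk k).2.1) hZsep hconv fun k => (hk k).2.2.2.2⟩
  obtain ⟨Z, hZC, hrec⟩ := minimalRecurrent δ hδ _ hne hsepC h0C hrootC hclosedC
  obtain ⟨hZ0, hZsep, hZsolid, hZW, hZflat⟩ := mem_hull.1 hZC
  -- the recurrent law at margin `t/2` charges `Z`, contradicting its flatness
  have hRSD : RobustlySealedDense a (t / 2) (W₀ + 1) P₀ Z := by
    refine ⟨L, fun p hp => ?_⟩
    obtain ⟨y, hy, y', hy', hd, hcl, hW, hnl⟩ := hZW p hp
    have hc := hcl (t / 2) (by linarith) (by linarith)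
    exact ⟨y, hy, y', hy', hd, hc.1, hc.2, hW, hnl⟩
  obtain ⟨η, hη, hcubes⟩ := h e hT hLB Z ⟨δ, hδ, hZsep⟩ hZ0 hrec hZsolid a ha ha1 (t / 2) (by linarith) hRSD
  obtain ⟨ℓ, c, F, hℓ, hF, hlt⟩ := hcubes (m η)
  have := hZflat η hη ℓ c F hℓ hF
  linarith

/-! ## §J (ii)  Pins to the registered numerals of law 4 -/

/-- The recurrent class decides the registered stub `SealedChargeLaw 24 48 10` of the line «HostedDustCut». -/
theorem sealedChargeLaw_numerals_of_recurrent (h : RecurrentSealedChargeLaw 24 48) : SealedChargeLaw 24 48 10 :=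
  sealedChargeLaw_of_recurrentSealedChargeLaw 24 48 10 h

/-- … and a fortiori the landed `WallTension 25 48` bridge target is implied by neither; both feed law 4. -/
theorem sealedChargeLaw_text_of_recurrent (h : RecurrentSealedChargeLaw 24 48) :
    (∀ e : ℝ, Filter.Tendsto (fun N : ℕ => groundStateEnergy lennardJones 3 N / N) Filter.atTop (nhds e) →
      (∀ N : ℕ, 0 < N → e ≤ groundStateEnergy lennardJones 3 N / N) →
      ∀ Y : Set (EuclideanSpace ℝ (Fin 3)), UniformlyDiscrete Y → (∀ z, ∃ w ∈ Y, dist z w < 9 / 10) →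
      ∀ a : ℝ, 47 / 50 ≤ a → a ≤ 1 → ∀ t : ℝ, 0 < t → MAT a Y → ThinCores a 10 Y → SealedDense a t (24 + 1) 48 Y →
      (∃ η : ℝ, 0 < η ∧ ∀ ℓ₀ : ℝ, ∃ ℓ : ℝ, ∃ c : (EuclideanSpace ℝ (Fin 3)), ∃ F : Finset (EuclideanSpace ℝ (Fin 3)), ℓ₀ ≤ ℓ ∧
        (↑F : Set (EuclideanSpace ℝ (Fin 3))) = Y ∩ {z | ∀ i : Fin 3, c i ≤ z i ∧ z i < c i + ℓ} ∧
        η * ℓ ^ 3 < ∑ y ∈ F, ((∑' w : ↥Y, lennardJones (dist y (w : (EuclideanSpace ℝ (Fin 3))))) - 2 * e))) :=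
  sealedChargeLaw_of_recurrentSealedChargeLaw 24 48 10 h

end Summit.AtomisticToContinuum.Crystallization.Theorems.OverbindingBudgetRecurrentSeal

end
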